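import Mathlib
import HarnessLib
import Summits.HubbardSuperconductivity.HubbardSuperconductivity.Theorems.KLProgrammeC4aSecondCumulantTadpoleLegs
import Summits.HubbardSuperconductivity.HubbardSuperconductivity.Theorems.KLProgrammeC4aBareTadpoleVertex
import Summits.HubbardSuperconductivity.HubbardSuperconductivity.Theorems.KLProgrammeKLRegimeSplitTwoLegCounterVertex

/-!
# Route `KLProgramme` — crux C4a, S1 (c)/(d): THE TADPOLE VERTEX OF `𝒱_n` SPLIT TO SECOND ORDER at every pair of continuum momenta, and the dressed
# two-leg kernel (frame + Hartree) in closed form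

Cell `gate-hubbard-kl`, lane hubbard-kl-c4a-1 (g6); helper for stub (C) `stub_twoLeg_curvature` of the engine-flow child `KLRegimeEngineV17F2`
(stmt-HubbardSuperconductivity-20437); memo HOME/hubbard-kl-c4a-1/C4A-PLAN.md §22.10.  Input (i) of the (A) capstone
(`…C4aSliceIncrementAssembly.twoLegCurveJetBound_succ_of_inputs_ref`) is a co-moving jet bound on `tadpoleVertex β 𝒱_n p₀ − V★`.  Here `𝒱_n = effAction C W`,
`C = C^K_{>Λ_n} = klHardCov … n`, `W = V_U + 𝒩_K`, is split AS A GRASSMANN ELEMENT `W + Δ_C W + (e^{Δ_C}W − W − Δ_C W) − ½·cum + T₃`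
(`cum = e^{Δ_C}(WW) − (e^{Δ_C}W)²`, `T₃ = 𝒱_n − e^{Δ_C}W + ½cum` the third-order tail), and `tadpoleVertex β · p₀` (linear, reads only the quartic kernel) is applied:

* §1 `tadpoleVertex_eq_zero_of_kernel_four` (no quartic kernel ⇒ no tadpole vertex); hence `Δ_C W` and `e^{Δ_C}W − W − Δ_C W` drop
  (`…C4aSecondCumulantLines.kernel_four_grassmannLaplacian_hubbardInteractionCT`, `…kernel_four_gaussConv_sub_sub_hubbardInteractionCT`);
* §2 **`tadpoleVertex_klEffectiveAction_split`**: for ALL continuum `P, q`,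
  `tadpoleVertex β 𝒱_n p₀ P q = −U/(β²L²) − ½·tadpoleVertex β cum_n p₀ P q + tadpoleVertex β T₃,n p₀ P q` — the Hartree constant (θ-blind, the reference vertex
  `V★` of `…C4aTadpoleJetAssemblyRef`), the second-order vertex of `…C4aSecondCumulantTadpoleLegs.tadpoleVertex_secondCumulant_latticeMomentum` (pp bubble at
  `K + Q`, ph-crossed at `K − Q`, constant, trees), and the third-order tail;
* §3 the dressed two-leg kernel on the reciprocal pair in closed form for `C = C^K_{>Λ}`:
  `kernel (e^{Δ_C}W) 2 (ψ̂⁺_{ks}, ψ̂⁻_{ks}) = K(p_k⃗)/(2βL²) − 12c_U·Σ_p w^K_Λ(p)·βL²·(iω_p + e_K(p⃗))/nambuDenCT(p)` (frame + Hartree, spin- and frequency-blind up to the frame),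
  which makes the trees of the second-order vertex explicit (`kernel_two_gaussConv_hubbardInteractionCT_plus_minus`).

Exact algebra; nothing about sizes; nothing asserts superconductivity.  References: Salmhofer 1999 §2.4 [cite: Salmhofer1999]; BGM 2006 §2.3 [cite: BenfattoGiulianiMastropietro2006].
-/

noncomputable section

namespace Summit.HubbardSuperconductivity.HubbardSuperconductivity.Theorems.C4a

set_option linter.dupNamespace false -- summit = problem name (single-conjunct summit), D-0017

open Literature.MathematicalPhysics.QuantumLattice Literature.Probability.LatticeModels GrassmannAlgebra Finset Matrix
open Summit.HubbardSuperconductivity.HubbardSuperconductivity.Theorems.KLRegimeWick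
open Summit.HubbardSuperconductivity.HubbardSuperconductivity.Theorems.KLRegimeSplit
open Summit.HubbardSuperconductivity.HubbardSuperconductivity.Theorems.KLProgrammeLegKernels
open Summit.HubbardSuperconductivity.HubbardSuperconductivity.Theorems.TwoPointAssembly

variable {L M : ℕ} [NeZero L] [NeZero M]

/-! ## §1 No quartic kernel ⇒ no tadpole vertex -/

/-- The zero element has zero tadpole vertex. -/
theorem tadpoleVertex_zero (β : ℝ) (p₀ : MatsubaraIdx M) (Pm q : Momentum) : tadpoleVertex β (0 : HubbardGrassmann L M) p₀ Pm q = 0 := by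
  have h := congrFun (congrFun (tadpoleVertex_smul β (0 : ℂ) (0 : HubbardGrassmann L M) p₀) Pm) q
  rw [zero_smul] at h
  rw [h, zero_mul]

/-- **An element without quartic kernel has no tadpole vertex** (`tadpoleVertex` reads only `kernel · 4`, `…C4aBareTadpoleVertex.positionKernel_four_congr`). -/
theorem tadpoleVertex_eq_zero_of_kernel_four (β : ℝ) {G : HubbardGrassmann L M} (h : ∀ X, kernel ℂ G 4 X = 0) (p₀ : MatsubaraIdx M) (Pm q : Momentum) :
    tadpoleVertex β G p₀ Pm q = 0 := by
  have hG : ∀ X, kernel ℂ G 4 X = kernel ℂ (0 : HubbardGrassmann L M) 4 X := fun X => by rw [h X, kernel_zero_right]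
  have hV : tadpoleVertex β G p₀ = tadpoleVertex β (0 : HubbardGrassmann L M) p₀ := by
    funext Pm' q'
    simp only [tadpoleVertex, tadpoleCoeff, loopCoeffCont, positionKernel_four_congr β hG]
  rw [hV, tadpoleVertex_zero]

/-- `Δ_C W` (`W = V_U + 𝒩_K`) has no tadpole vertex. -/
theorem tadpoleVertex_grassmannLaplacian_hubbardInteractionCT (β U : ℝ) (K : TrigPolyC4v) (C : Matrix (HubbardFieldIdx L M) (HubbardFieldIdx L M) ℂ)
    (p₀ : MatsubaraIdx M) (Pm q : Momentum) : tadpoleVertex β (grassmannLaplacian ℂ C (hubbardInteractionCT L M β U K)) p₀ Pm q = 0 :=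
  tadpoleVertex_eq_zero_of_kernel_four β (kernel_four_grassmannLaplacian_hubbardInteractionCT β U K C) p₀ Pm q

/-- `e^{Δ_C}W − W − Δ_C W` has no tadpole vertex. -/
theorem tadpoleVertex_gaussConv_sub_sub_hubbardInteractionCT (β U : ℝ) (K : TrigPolyC4v) (C : Matrix (HubbardFieldIdx L M) (HubbardFieldIdx L M) ℂ)
    (p₀ : MatsubaraIdx M) (Pm q : Momentum) :
    tadpoleVertex β (gaussConv ℂ C (hubbardInteractionCT L M β U K) - hubbardInteractionCT L M β U K -
      grassmannLaplacian ℂ C (hubbardInteractionCT L M β U K)) p₀ Pm q = 0 :=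
  tadpoleVertex_eq_zero_of_kernel_four β (kernel_four_gaussConv_sub_sub_hubbardInteractionCT β U K C) p₀ Pm q

/-! ## §2 The tadpole vertex of `𝒱_n` to second order -/

/-- Pointwise additivity / homogeneity of `tadpoleVertex` (from the function-level `tadpoleVertex_add/_sub/_smul`). -/
theorem tadpoleVertex_add_apply (β : ℝ) (W₁ W₂ : HubbardGrassmann L M) (p₀ : MatsubaraIdx M) (Pm q : Momentum) :
    tadpoleVertex β (W₁ + W₂) p₀ Pm q = tadpoleVertex β W₁ p₀ Pm q + tadpoleVertex β W₂ p₀ Pm q :=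
  congrFun (congrFun (tadpoleVertex_add β W₁ W₂ p₀) Pm) q

/-- Pointwise homogeneity. -/
theorem tadpoleVertex_smul_apply (β : ℝ) (c : ℂ) (W : HubbardGrassmann L M) (p₀ : MatsubaraIdx M) (Pm q : Momentum) :
    tadpoleVertex β (c • W) p₀ Pm q = c * tadpoleVertex β W p₀ Pm q :=
  congrFun (congrFun (tadpoleVertex_smul β c W p₀) Pm) q

/-- **THE TADPOLE VERTEX OF `𝒱_n` SPLIT TO SECOND ORDER** (`β ≠ 0`; every frame `K`, every scale `n`, ALL continuum momenta `P, q`): with `C = C^K_{>Λ_n} = klHardCov … n`,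
`W = V_U + 𝒩_K`, `cum = e^{Δ_C}(W·W) − e^{Δ_C}W·e^{Δ_C}W`, `T₃ = 𝒱_n − e^{Δ_C}W + ½cum`:
`tadpoleVertex β 𝒱_n p₀ P q = −U/(β²L²) − ½·tadpoleVertex β cum p₀ P q + tadpoleVertex β T₃ p₀ P q`. [cite: Salmhofer1999, §2.4] -/
theorem tadpoleVertex_klEffectiveAction_split {β : ℝ} (hβ : β ≠ 0) (U μ : ℝ) (K : TrigPolyC4v) (n : ℕ) (p₀ : MatsubaraIdx M) (Pm q : Momentum) :
    tadpoleVertex β (klEffectiveAction L M β U μ K klE0 n) p₀ Pm q =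
      (((-(U / (β ^ 2 * (L : ℝ) ^ 2))) : ℝ) : ℂ) -
        (2 : ℂ)⁻¹ * tadpoleVertex β (gaussConv ℂ (klHardCov L M β μ K n) (hubbardInteractionCT L M β U K * hubbardInteractionCT L M β U K) -
          gaussConv ℂ (klHardCov L M β μ K n) (hubbardInteractionCT L M β U K) * gaussConv ℂ (klHardCov L M β μ K n) (hubbardInteractionCT L M β U K)) p₀ Pm q +
        tadpoleVertex β (klEffectiveAction L M β U μ K klE0 n - gaussConv ℂ (klHardCov L M β μ K n) (hubbardInteractionCT L M β U K) +
          (2 : ℂ)⁻¹ • (gaussConv ℂ (klHardCov L M β μ K n) (hubbardInteractionCT L M β U K * hubbardInteractionCT L M β U K) -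
            gaussConv ℂ (klHardCov L M β μ K n) (hubbardInteractionCT L M β U K) * gaussConv ℂ (klHardCov L M β μ K n) (hubbardInteractionCT L M β U K))) p₀ Pm q := by
  set C := klHardCov L M β μ K n with hCdef
  set W := hubbardInteractionCT L M β U K with hWdef
  set cum := gaussConv ℂ C (W * W) - gaussConv ℂ C W * gaussConv ℂ C W with hcum
  -- the Grassmann-level split
  have hsplit : klEffectiveAction L M β U μ K klE0 n =
      W + grassmannLaplacian ℂ C W + (gaussConv ℂ C W - W - grassmannLaplacian ℂ C W) + (-(2 : ℂ)⁻¹) • cum +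
        (klEffectiveAction L M β U μ K klE0 n - gaussConv ℂ C W + (2 : ℂ)⁻¹ • cum) := by
    rw [neg_smul]
    abel
  conv_lhs => rw [hsplit]
  rw [tadpoleVertex_add_apply, tadpoleVertex_add_apply, tadpoleVertex_add_apply, tadpoleVertex_add_apply, tadpoleVertex_smul_apply,
    tadpoleVertex_gaussConv_sub_sub_hubbardInteractionCT, tadpoleVertex_grassmannLaplacian_hubbardInteractionCT, tadpoleVertex_hubbardInteractionCT_eq_const hβ]
  ring

/-! ## §3 The dressed two-leg kernel on the reciprocal pair, in closed form -/

omit [NeZero L] [NeZero M] in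
/-- `Fin.snoc (Fin.snoc (a, b) c) d = (a, b, c, d)`. -/
theorem snoc_snoc_two (a b c d : HubbardFieldIdx L M) :
    (Fin.snoc (Fin.snoc (![a, b] : Fin 2 → HubbardFieldIdx L M) c : Fin (2 + 1) → HubbardFieldIdx L M) d : Fin (2 + 2) → HubbardFieldIdx L M) = ![a, b, c, d] := by
  funext i
  fin_cases i <;> rfl

omit [NeZero M] in
/-- The bare quartic kernel at `(ψ̂⁺_{ks}, ψ̂⁻_{ks}, ψ̂⁻_{pσ}, ψ̂⁺_{pσ})`: `−[s ≠ σ]·c_U` (the Hartree tadpole's vertex; `c_U = U(βL²)⁻³(4!)⁻¹`). -/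
theorem kernel_hubbardInteraction_plus_minus_minus_plus (β U : ℝ) (k p : FreqMomentum L M) (s σ : Fin 2) :
    kernel ℂ (hubbardInteraction L M β U) 4 ![((k, s), 0), ((k, s), 1), ((p, σ), 1), ((p, σ), 0)] =
      if s = σ then 0 else -((((U / (β * (L : ℝ) ^ 2) ^ 3 : ℝ)) : ℂ) * (((4 : ℕ).factorial : ℚ)⁻¹ • (1 : ℂ))) := by
  rw [kernel_hubbardInteraction_pmmp, kernel_hubbardInteraction_mmpp]
  by_cases h : s = σ
  · simp [h]
  · simp [h]

omit [NeZero M] in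
/-- **THE DRESSED TWO-LEG KERNEL ON THE RECIPROCAL PAIR** (`C = C^K_{>Λ}`, any frame, any cutoff):
`kernel (e^{Δ_C}(V_U + 𝒩_K)) 2 (ψ̂⁺_{ks}, ψ̂⁻_{ks}) = (K(p_k⃗)/(βL²))·(2!)⁻¹ − 12·c_U·Σ_p w^K_Λ(p)·βL²·(iω_p + e_K(p⃗))/nambuDenCT(p)` — the frame plus the Hartree constant
(one spin runs in the loop: the opposite one); frequency-blind, spin-blind, `k⃗`-dependent only through the frame. [cite: Salmhofer1999, §2.4] -/
theorem kernel_two_gaussConv_hubbardInteractionCT_plus_minus (β U μ : ℝ) (K : TrigPolyC4v) (Λ : ℝ) (k : FreqMomentum L M) (s : Fin 2) :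
    kernel ℂ (gaussConv ℂ (hubbardCovAboveCT L M β μ 0 K Λ) (hubbardInteractionCT L M β U K)) 2 ![((k, s), 0), ((k, s), 1)] =
      ((K.eval (latticeMomentum L k.2) / (β * (L : ℝ) ^ 2) : ℝ) : ℂ) * (((2 : ℕ).factorial : ℚ)⁻¹ • (1 : ℂ)) -
        12 * ((((U / (β * (L : ℝ) ^ 2) ^ 3 : ℝ)) : ℂ) * (((4 : ℕ).factorial : ℚ)⁻¹ • (1 : ℂ))) *
          ∑ p : FreqMomentum L M, (hubbardCutoffWeightCT L M β μ K Λ p : ℂ) *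
            (((β * (L : ℝ) ^ 2 : ℝ) : ℂ) * ((Complex.I * matsubaraFreq β M p.1 + nambuXiCT L μ K p.2) / nambuDenCT L M β μ 0 K p)) := by
  rw [kernel_two_gaussConv_hubbardInteractionCT, TwoLegFourier.kernel_counterQuadratic_two_string, sub_eq_add_neg]
  congr 1
  -- the Hartree loop: `kernel₂(Δ_C V_U) = kernel₂(Δ_C (V_U + 𝒩_K))` and p1/r2d-p1's tadpole formula
  have hV : grassmannLaplacian ℂ (hubbardCovAboveCT L M β μ 0 K Λ) (hubbardInteraction L M β U) =
      grassmannLaplacian ℂ (hubbardCovAboveCT L M β μ 0 K Λ) (hubbardInteractionCT L M β U K) -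
        grassmannLaplacian ℂ (hubbardCovAboveCT L M β μ 0 K Λ) (counterQuadratic L M β K) := by
    rw [hubbardInteractionCT, map_add, add_sub_cancel_right]
  have hN : kernel ℂ (grassmannLaplacian ℂ (hubbardCovAboveCT L M β μ 0 K Λ) (counterQuadratic L M β K)) 2 ![((k, s), 0), ((k, s), 1)] = 0 :=
    kernel_grassmannLaplacian_eq_zero_of ℂ _ (fun Y => kernel_counterQuadratic_of_ne_two β K (by norm_num) Y) _
  have h44 : ∀ (p : FreqMomentum L M) (σ' : Fin 2),
      kernel ℂ (hubbardInteraction L M β U) (2 + 2)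
          (Fin.snoc (Fin.snoc (![((k, s), 0), ((k, s), 1)] : Fin 2 → HubbardFieldIdx L M) (((p, σ'), 1) : HubbardFieldIdx L M) :
            Fin (2 + 1) → HubbardFieldIdx L M) ((p, σ'), 0)) =
        if s = σ' then 0 else -((((U / (β * (L : ℝ) ^ 2) ^ 3 : ℝ)) : ℂ) * (((4 : ℕ).factorial : ℚ)⁻¹ • (1 : ℂ))) := by
    intro p σ'
    rw [snoc_snoc_two]
    exact kernel_hubbardInteraction_plus_minus_minus_plus β U k p s σ'
  rw [hV, kernel_sub', hN, sub_zero, kernel_two_grassmannLaplacian_hubbardCovAboveCT_interactionCT, Fintype.sum_prod_type]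
  simp_rw [h44, Fin.sum_univ_two]
  rw [Finset.mul_sum, Finset.mul_sum, ← Finset.sum_neg_distrib]
  refine Finset.sum_congr rfl fun p _ => ?_
  have two : s = 0 ∨ s = 1 := by fin_cases s <;> simp
  rcases two with rfl | rfl <;> simp <;> ring

end Summit.HubbardSuperconductivity.HubbardSuperconductivity.Theorems.C4a

end
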